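import Summits.Ventures.Crystal3D.Theorems.StickyWulffConstantPolycrystalWulffBoundSuperTreeTrim
import Summits.Ventures.Crystal3D.Theorems.StickyWulffConstantPolycrystalWulffBoundRungSingleAxis

/-!
# `PolycrystalWulffBound`, line `PolyDensity`: the rung for a TREE OF SUPER-GRAINS (local accounting)

Route `StickyWulffConstant`, venture `Summits/Ventures/Crystal3D`, crux `PolycrystalWulffBound`
(`stmt-Ventures-19482`), second prover lane (poly-p2, gen 13).  TEXTURE: pairwise disjoint bounded open
convex cells `Q_j` with separating normals `ν_{jj'}`, frames `A_j`, Boolean labels `τ_j`, grouped into the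
NODES `nd j ∈ Fin (N+1)` of a tree (root `0`, parent of `i.succ` is `par i ≤ i`).  Each node `f` is
either SINGLE-BODY (`slid f = false`: every cell has the body `W(Aref f)`) or SLID (`slid f = true`: a
single-axis twin network — cells co-axial with `Aref f` about `mS f`, horizontal bond and mirror normal
`uS f`, slide direction `wS f ⊥ mS f, uS f`, equal labels ⇒ equal bodies).  Tree edge `i`: unit normal
`nrm i`, threshold `thr i`; node `i.succ` lies in `{thr i < ⟪x, nrm i⟫}`, node `par i` lies in
`{⟪x, nrm i⟫ < thr i}` wherever `δ`-close to node `i.succ`; non-adjacent nodes are `δ`-separated; the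
reference bodies of `par i` and `i.succ` have EQUAL CAP-VOLUME PROFILES along `nrm i` (basal / vertical /
co-axial-`⊥ w` walls, see `…SuperTreeNodes`); and `nrm i ⊥ wS` of every SLID incident node.
CONCLUSION (`rung_superTree_cells`):
`6·2^{1/3}(√2·Vol)^{2/3} ≤ Fr + (1/√6)·Σ_{j,j' : nd j = nd j', slid, τ_j ≠ τ_j'} |⟪wS, ν_{jj'}⟫|·facetArea`
— the wall budget is LOCAL: only twin walls INSIDE a slid node are charged (at `(2/√6)|⟪w_node, ν⟫|` per
area, double sum), the tree edges between nodes cost nothing.  Unifies `rung_singleAxis_cells` (one slid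
node) with `rung_sortedTree` (all nodes single grains).  PROOF: trim inside slid nodes
(`exists_superTree_trim`, `volume_lineTrimE3_le`), trimmed chimera bound (`superTree_trimmed_lower`),
Minkowski content (`volume_chimera_texture_le`), cube expansion (`cube_tail_bound`), `r → 0`.
WHAT THIS IS NOT: cycles of nodes; inclined junctions BETWEEN nodes; the crux is not claimed.
-/

noncomputable section

open scoped BigOperators InnerProductSpace ENNReal Pointwise
open MeasureTheory Filter Set

namespace Summit.Ventures.Crystal3D.Cruxes.PolycrystalWulffBound.PolyDensity

open Summit.Ventures.Crystal3D.Theorems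
open Summit.Ventures.Crystal3D.Cruxes.TextureLiminf.TexShadow (per polytope E3 facetArea)
open Literature.MathematicalPhysics.StatisticalMechanics (fccStacking barlowStacking IsHaggSeq perimeter)

set_option maxHeartbeats 400000 in
/-- **Rung `rung_superTree_cells`** (let-vocabulary of the planner's rungs; cell form): a sorted tree of
super-grains — single-body nodes and slid single-axis twin nodes joined through profile-matching walls
`⊥` the incident slide directions — satisfies
`6·2^{1/3}(√2·Vol)^{2/3} ≤ Fr + (1/√6)·Σ_{nd j = nd j', slid (nd j), τ j ≠ τ j'} |⟪wS (nd j), ν_{jj'}⟫|·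
facetArea(cl Q_j ∩ cl Q_j')`. -/
theorem rung_superTree_cells : let Λ : Set (EuclideanSpace ℝ (Fin 3)) := Literature.MathematicalPhysics.StatisticalMechanics.fccStacking 1 (Real.sqrt (2 / 3)); let Brl : (ℤ → ℤ) → Set (EuclideanSpace ℝ (Fin 3)) := Literature.MathematicalPhysics.StatisticalMechanics.barlowStacking 1 (Real.sqrt (2 / 3)); let Ax : EuclideanSpace ℝ (Fin 3) → (EuclideanSpace ℝ (Fin 3) ≃ₗᵢ[ℝ] EuclideanSpace ℝ (Fin 3)) → (EuclideanSpace ℝ (Fin 3) ≃ₗᵢ[ℝ] EuclideanSpace ℝ (Fin 3)) → Prop := fun m A B => ∃ (L : EuclideanSpace ℝ (Fin 3) ≃ₗᵢ[ℝ] EuclideanSpace ℝ (Fin 3)) (s₁ s₂ : EuclideanSpace ℝ (Fin 3)) (σ σ' : ℤ → ℤ), Literature.MathematicalPhysics.StatisticalMechanics.IsHaggSeq σ ∧ Literature.MathematicalPhysics.StatisticalMechanics.IsHaggSeq σ' ∧ L (EuclideanSpace.single (2 : Fin 3) (1 : ℝ)) = m ∧ A '' Λ ⊆ (fun q => L q +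 s₁) '' Brl σ ∧ B '' Λ ⊆ (fun q => L q + s₂) '' Brl σ'; let Φ : EuclideanSpace ℝ (Fin 3) → ℝ := fun ν => Real.sqrt 2 / 4 * ∑ᶠ w ∈ {w ∈ Λ | ‖w‖ = 1}, |⟪w, ν⟫_ℝ|; let Per : Set (EuclideanSpace ℝ (Fin 3)) → Set (EuclideanSpace ℝ (Fin 3)) → ℝ := fun K S => (⨆ (ξ : EuclideanSpace ℝ (Fin 3) → EuclideanSpace ℝ (Fin 3)) (_ : ContDiff ℝ 1 ξ ∧ HasCompactSupport ξ ∧ ∀ z, ξ z ∈ K), ENNReal.ofReal (∫ z in S, Literature.MathematicalPhysics.StatisticalMechanics.fieldDivergence ξ z)).toReal; let ι : Set (EuclideanSpace ℝ (Fin 3)) → Set (EuclideanSpace ℝ (Fin 3)) → Set (EuclideanSpace ℝ (Fin 3)) → ℝ := fun K S₁ S₂ => (Per K S₁ + Per K S₂ - Per K (S₁ ∪ S₂)) / 2; let W : (EuclideanSpace ℝ (Fin 3) ≃ₗᵢ[ℝ] EuclideanSpace ℝ (Fin 3)) → Set (EuclideanSpace ℝ (Fin 3)) := fun A => {y | ∀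 ν : EuclideanSpace ℝ (Fin 3), ⟪y, ν⟫_ℝ ≤ Φ (A.symm ν)}; let Vol : (n : ℕ) → (Fin n → Set (EuclideanSpace ℝ (Fin 3))) → ℝ := fun n G => (volume (⋃ f : Fin n, G f)).toReal; let Fr : (n : ℕ) → (Fin n → Set (EuclideanSpace ℝ (Fin 3))) → (Fin n → (EuclideanSpace ℝ (Fin 3) ≃ₗᵢ[ℝ] EuclideanSpace ℝ (Fin 3))) → ℝ := fun n G A => ∑ f : Fin n, Per (W (A f)) (G f) - ∑ f, ∑ g, (if f = g then 0 else ι (W (A f)) (G f) (G g)); ∀ (k : ℕ) (H : Fin k → Finset ((EuclideanSpace ℝ (Fin 3)) × ℝ)), let Q : Fin k → Set (EuclideanSpace ℝ (Fin 3)) := fun j => ⋂ p ∈ H j, {x : EuclideanSpace ℝ (Fin 3) | ⟪p.1, x⟫_ℝ < p.2}; ∀ (A : Fin k → (EuclideanSpace ℝ (Fin 3) ≃ₗᵢ[ℝ] EuclideanSpace ℝ (Fin 3))) (nv : Fin k → Fin k → EuclideanSpace ℝ (Fin 3)) (τ : Fin k → Bool) (N : ℕ) (par : Fin N → Fin (N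 + 1)) (nrm : Fin N → EuclideanSpace ℝ (Fin 3)) (thr : Fin N → ℝ) (nd : Fin k → Fin (N + 1)) (Aref : Fin (N + 1) → (EuclideanSpace ℝ (Fin 3) ≃ₗᵢ[ℝ] EuclideanSpace ℝ (Fin 3))) (slid : Fin (N + 1) → Bool) (mS uS wS : Fin (N + 1) → EuclideanSpace ℝ (Fin 3)) (δ : ℝ), (∀ j, Bornology.IsBounded (Q j)) → (∀ j j', j ≠ j' → Disjoint (Q j) (Q j')) → (∀ i j, nv j i = -nv i j) → (∀ j j', j ≠ j' → ‖nv j j'‖ = 1 ∧ ∃ b : ℝ, closure (Q j) ∩ closure (Q j') ⊆ {x | ⟪nv j j', x⟫_ℝ = b}) → (∀ i, (par i : ℕ) ≤ i) → (∀ i, ‖nrm i‖ = 1) → (∀ i (s : ℝ), volume (W (Aref i.succ) ∩ {y | s < ⟪y, nrm i⟫_ℝ}) = volume (W (Aref (par i)) ∩ {y | s < ⟪y, nrm i⟫_ℝ})) → (∀ i j, nd j = i.succ → ∀ x ∈ Q j, thr i < ⟪x, nrm i⟫_ℝ) → 0 < δ → (∀ i j, nd j = par i → ∀ x ∈ Q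 j, ⟪x, nrm i⟫_ℝ < thr i ∨ ∀ j', nd j' = i.succ → ∀ y ∈ Q j', δ ≤ dist x y) → (∀ j j', nd j ≠ nd j' → (∀ i, ¬ (nd j = par i ∧ nd j' = i.succ)) → (∀ i, ¬ (nd j' = par i ∧ nd j = i.succ)) → ∀ x ∈ Q j, ∀ y ∈ Q j', δ ≤ dist x y) → (∀ j, slid (nd j) = false → W (A j) = W (Aref (nd j))) → (∀ j, slid (nd j) = true → Ax (mS (nd j)) (Aref (nd j)) (A j)) → (∀ f, slid f = true → ‖uS f‖ = 1 ∧ ‖wS f‖ = 1 ∧ ⟪uS f, mS f⟫_ℝ = 0 ∧ ⟪wS f, mS f⟫_ℝ = 0 ∧ ⟪wS f, uS f⟫_ℝ = 0) → (∀ f, slid f = true → uS f ∈ Aref f '' Λ ∧ (ℝ ∙ uS f)ᗮ.reflection '' (Aref f '' Λ) = Aref f '' Λ) → (∀ j j', nd j = nd j' → τ j = τ j' → W (A j) = W (A j')) → (∀ i, slid (par i) = true → ⟪nrm i, wS (par i)⟫_ℝ = 0) → (∀ i, slid i.succ = true → ⟪nrm i, wS i.succ⟫_ℝ = 0) → 6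 * (2 : ℝ) ^ ((1 : ℝ) / 3) * (Real.sqrt 2 * Vol k Q) ^ ((2 : ℝ) / 3) ≤ Fr k Q A + 1 / Real.sqrt 6 * ∑ j, ∑ j', (if (nd j = nd j' ∧ slid (nd j) = true ∧ τ j ≠ τ j') then |⟪wS (nd j), nv j j'⟫_ℝ| * facetArea (closure (Q j) ∩ closure (Q j')) (nv j j') else 0) := by
  intro Λ Brl Ax Φ Per ι W Vol Fr k H Q A nv τ N par nrm thr nd Aref slid mS uS wS δ hbd hdisj hanti hplane
    hpar hn1 hprof hGt hδ hPt hfar hN1 hN2 hON hBM hτ hNa hNb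
  have hQpoly : ∀ j, Q j = polytope (H j) := fun j => rfl
  set Bd : Fin k → Set E3 := fun j => W (A j) with hBd
  set term : Fin k → Fin k → ℝ := fun i j =>
    |⟪wS (nd i), nv i j⟫_ℝ| * facetArea (closure (Q i) ∩ closure (Q j)) (nv i j) with hterm
  set S : ℝ := ∑ j, ∑ j', (if (nd j = nd j' ∧ slid (nd j) = true ∧ τ j ≠ τ j') then term j j' else 0)
    with hS
  show 6 * (2 : ℝ) ^ ((1 : ℝ) / 3) * (Real.sqrt 2 * (volume (⋃ j, Q j)).toReal) ^ ((2 : ℝ) / 3) ≤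
    (∑ f, Per (W (A f)) (Q f) - ∑ f, ∑ g, (if f = g then 0 else ι (W (A f)) (Q f) (Q g))) +
      1 / Real.sqrt 6 * S
  rw [← Finset.sum_sub_distrib]
  set F : ℝ := ∑ f, (Per (W (A f)) (Q f) - ∑ g, (if f = g then 0 else ι (W (A f)) (Q f) (Q g))) with hF
  have hQo : ∀ j, IsOpen (Q j) := fun j =>
    isOpen_biInter_finset fun q _ => isOpen_lt (continuous_const.inner continuous_id) continuous_const
  have hQv : ∀ j, Convex ℝ (Q j) := fun j =>
    convex_iInter₂ fun q _ => convex_halfSpace_lt (innerSL ℝ q.1).isLinear q.2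
  have hvolQ : ∀ j, volume (Q j) < ⊤ := by
    intro j
    obtain ⟨R, hR⟩ := (hbd j).subset_closedBall 0
    exact lt_of_le_of_lt (measure_mono hR) measure_closedBall_lt_top
  have hPolyQ : ∀ j, ∃ (k' : ℕ) (H' : Fin k' → Finset (E3 × ℝ)), Q j = ⋃ i, polytope (H' i) :=
    fun j => ⟨1, fun _ => H j, by rw [hQpoly]; ext x; simp⟩
  have hWc : ∀ f, IsCompact (W (A f)) := fun f => isCompact_cruxWulffBody (A f)
  have hWv : ∀ f, Convex ℝ (W (A f)) := fun f => convex_cruxWulffBody (A f)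
  have hW0 : ∀ f, (0 : E3) ∈ W (A f) := fun f => zero_mem_cruxWulffBody (A f)
  have hWs : ∀ f, -W (A f) = W (A f) := fun f => neg_cruxWulffBody_eq (A f)
  have hFr0 : 0 ≤ F := by
    have h := freeEnergy_ge_mul_perimeter Q hPolyQ hvolQ hdisj (fun f => W (A f)) hWc hWv hW0 hWs
      (Real.sqrt_pos.2 (by norm_num : (0:ℝ) < 3)) (fun f => closedBall_subset_cruxWulffBody (A f))
    exact le_trans (mul_nonneg (Real.sqrt_nonneg 3) ENNReal.toReal_nonneg) h
  have hterm0 : ∀ i j, 0 ≤ term i j := fun i j => mul_nonneg (abs_nonneg _) ENNReal.toReal_nonneg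
  have htermsymm : ∀ i j, nd i = nd j → term j i = term i j := by
    intro i j hij
    simp only [hterm]
    rw [hij, hanti i j, inner_neg_right, abs_neg, Set.inter_comm, facetArea_neg]
  have hS0 : 0 ≤ S := Finset.sum_nonneg fun j _ => Finset.sum_nonneg fun j' _ => by
    split_ifs; exacts [hterm0 j j', le_rfl]
  set V : ℝ := (volume (⋃ j, Q j)).toReal with hV
  have hV0 : 0 ≤ V := ENNReal.toReal_nonneg
  have hE'top : volume (⋃ j, Q j) ≠ ⊤ := by
    refine (lt_of_le_of_lt (measure_iUnion_le _) ?_).ne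
    rw [tsum_fintype]
    exact ENNReal.sum_lt_top.2 fun f _ => hvolQ f
  have h6 : (0 : ℝ) < Real.sqrt 6 := Real.sqrt_pos.2 (by norm_num)
  have h51 : (0 : ℝ) < 2 * (Real.sqrt 5 + 1) := by positivity
  by_cases hE'0 : volume (⋃ j, Q j) = 0
  · have hV00 : V = 0 := by rw [hV, hE'0, ENNReal.toReal_zero]
    rw [hV00, mul_zero, Real.zero_rpow (by norm_num), mul_zero]
    exact add_nonneg hFr0 (mul_nonneg (by positivity) hS0)
  have hVpos : 0 < V := ENNReal.toReal_pos hE'0 hE'top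
  -- unit axes of the slid nodes that carry a cell
  have hmS : ∀ j, slid (nd j) = true → ‖mS (nd j)‖ = 1 := by
    intro j hj
    obtain ⟨L, -, -, -, -, -, -, hLm, -, -⟩ := hN2 j hj
    rw [← hLm, LinearIsometryEquiv.norm_map, PiLp.norm_single, norm_one]
  set D : ℝ := 2 / Real.sqrt 6 with hD
  have hDpos : 0 < D := by positivity
  set c : ℝ := (32 : ℝ) ^ ((3 : ℝ)⁻¹) with hc
  have hc0 : 0 < c := by positivity
  -- the trimmed pairs
  set TP : Fin k → Fin k → Prop := fun i j =>
    nd i = nd j ∧ slid (nd j) = true ∧ τ i = true ∧ τ j = false with hTP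
  have key : ∀ ε : ℝ, 0 < ε → 3 * c * (V ^ ((3 : ℝ)⁻¹)) ^ 2 ≤ F + 1 / Real.sqrt 6 * S + ε := by
    intro ε hε
    obtain ⟨r₁, hr₁, hup⟩ := volume_chimera_texture_le Q hPolyQ hvolQ hdisj (fun f => W (A f))
      hWc hWv hW0 hWs (show (0:ℝ) < ε / 3 by positivity)
    set ε₂ : ℝ := ε / (3 * D * ((k : ℝ) ^ 2 + 1)) with hε₂
    have hε₂pos : 0 < ε₂ := by positivity
    have hpair : ∀ i j : Fin k, ∃ ρ₀ : ℝ, 0 < ρ₀ ∧ ∀ ρ : ℝ, 0 < ρ → ρ < ρ₀ → TP i j →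
        (volume (Q j ∩ {x : E3 | ∃ s ∈ Icc (-ρ) ρ, x + s • wS (nd j) ∈ Q i})).toReal ≤
          ρ * (term i j + ε₂) := by
      intro i j
      by_cases hP : TP i j
      · have hij : i ≠ j := fun e => by
          have h := hP.2.2; rw [e] at h; exact Bool.noConfusion (h.1.symm.trans h.2)
        obtain ⟨hν, b, hb⟩ := hplane i j hij
        obtain ⟨hu, hw, hum, hwm, hwu⟩ := hON (nd j) hP.2.1
        obtain ⟨ρ₀, hρ₀, h⟩ := volume_lineTrimE3_le (uS (nd j)) (wS (nd j)) (mS (nd j)) hu hw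
          (hmS j hP.2.1) hum hwm hwu (hQo i) (hQo j) (hQv i) (hQv j) (hdisj i j hij) (hbd j) hν hb
          hε₂pos
        refine ⟨ρ₀, hρ₀, fun ρ hρ hρρ₀ _ => ?_⟩
        have e : term i j = |⟪wS (nd j), nv i j⟫_ℝ| * facetArea (closure (Q i) ∩ closure (Q j)) (nv i j) := by
          simp only [hterm, hP.1]
        rw [e]; exact h ρ hρ hρρ₀
      · exact ⟨1, one_pos, fun ρ _ _ h => absurd h hP⟩
    choose ρ0 hρ0pos hρ0 using hpair
    obtain ⟨x₀, hx₀⟩ := nonempty_of_measure_ne_zero hE'0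
    obtain ⟨j₀, -⟩ := mem_iUnion.1 hx₀
    have huniv : (Finset.univ : Finset (Fin k × Fin k)).Nonempty := ⟨(j₀, j₀), Finset.mem_univ _⟩
    set ρbar : ℝ := Finset.univ.inf' huniv (fun p : Fin k × Fin k => ρ0 p.1 p.2) with hρbar
    have hρbar_pos : 0 < ρbar := by
      rw [hρbar, Finset.lt_inf'_iff]; intro p _; exact hρ0pos p.1 p.2
    have hρbar_le : ∀ i j, ρbar ≤ ρ0 i j := fun i j =>
      Finset.inf'_le (fun p : Fin k × Fin k => ρ0 p.1 p.2) (Finset.mem_univ (i, j))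
    set TAB : ℝ := ∑ j, ∑ i, (if (nd i = nd j ∧ slid (nd j) = true ∧ τ i = true ∧ τ j = false) then term i j else 0) with hTAB
    have hTAB0 : 0 ≤ TAB := Finset.sum_nonneg fun j _ => Finset.sum_nonneg fun i _ => by
      split_ifs; exacts [hterm0 i j, le_rfl]
    have hTABS : 2 * TAB ≤ S := by
      have hTAB' : TAB = ∑ j, ∑ i,
          (if (nd j = nd i ∧ slid (nd i) = true ∧ τ j = true ∧ τ i = false) then term i j else 0) := by
        rw [hTAB, Finset.sum_comm]
        refine Finset.sum_congr rfl fun j _ => Finset.sum_congr rfl fun i _ => ?_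
        by_cases h : TP j i
        · rw [if_pos h, if_pos h, htermsymm j i h.1]
        · rw [if_neg h, if_neg h]
      have hsum : TAB + TAB ≤ S := by
        have e1 : TAB + TAB = TAB + ∑ j, ∑ i,
            (if (nd j = nd i ∧ slid (nd i) = true ∧ τ j = true ∧ τ i = false) then term i j else 0) := by
          rw [← hTAB']
        rw [e1, hTAB, ← Finset.sum_add_distrib, hS]
        refine Finset.sum_le_sum fun j _ => ?_
        rw [← Finset.sum_add_distrib]
        refine Finset.sum_le_sum fun i _ => ?_
        by_cases h1 : TP i j
        · have h2 : ¬ TP j i := fun h => by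
            have e := h1.2.2.2.symm.trans h.2.2.1; exact Bool.noConfusion e
          have hsp : nd j = nd i ∧ slid (nd j) = true ∧ τ j ≠ τ i :=
            ⟨h1.1.symm, h1.2.1, by rw [h1.2.2.1, h1.2.2.2]; decide⟩
          rw [if_pos h1, if_neg h2, if_pos hsp, add_zero, htermsymm i j h1.1]
        · rw [if_neg h1, zero_add]
          by_cases h2 : TP j i
          · have hsp : nd j = nd i ∧ slid (nd j) = true ∧ τ j ≠ τ i :=
              ⟨h2.1, by rw [h2.1]; exact h2.2.1, by rw [h2.2.2.1, h2.2.2.2]; decide⟩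
            rw [if_pos h2, if_pos hsp, htermsymm i j h2.1.symm]
          · rw [if_neg h2]
            split_ifs; exacts [hterm0 j i, le_rfl]
      linarith only [hsum]
    set K : ℝ := TAB + (k : ℝ) ^ 2 * ε₂ with hK
    have hK0 : 0 ≤ K := by positivity
    set x : ℝ := V ^ ((3 : ℝ)⁻¹) with hx
    have hxpos : 0 < x := Real.rpow_pos_of_pos hVpos _
    have hx3 : x ^ 3 = V := by
      rw [hx, show ((3 : ℝ)⁻¹) = ((3 : ℕ) : ℝ)⁻¹ by norm_num]
      exact Real.rpow_inv_natCast_pow hV0 (by norm_num)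
    set r : ℝ := min (min (min (r₁ / 2) (ρbar / (2 * D))) (δ / (2 * (2 * (Real.sqrt 5 + 1)))))
      (min (V / (2 * D * (K + 1))) (ε * x / (18 * c * D * (K + 1)))) with hr
    have hr0 : 0 < r := by positivity
    clear_value r K TAB x ρbar ε₂
    have hrr₁ : r < r₁ := by
      have h : r ≤ r₁ / 2 := by
        rw [hr]; exact (min_le_left _ _).trans ((min_le_left _ _).trans (min_le_left _ _))
      linarith only [h, hr₁]
    have hrcD : 0 ≤ r * c * D := (mul_pos (mul_pos hr0 hc0) hDpos).le
    have hrD0 : 0 ≤ r * D := (mul_pos hr0 hDpos).le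
    have hrD : r * D < ρbar := by
      have h : r ≤ ρbar / (2 * D) := by
        rw [hr]; exact (min_le_left _ _).trans ((min_le_left _ _).trans (min_le_right _ _))
      have h' : r * (2 * D) ≤ ρbar := (le_div_iff₀ (by positivity)).1 h
      have e1 : r * (2 * D) = 2 * (r * D) := by ring
      rw [e1] at h'
      linarith [h', hρbar_pos, hrD0]
    have hrδ : r * (2 * (Real.sqrt 5 + 1)) ≤ δ := by
      have h : r ≤ δ / (2 * (2 * (Real.sqrt 5 + 1))) := by
        rw [hr]; exact (min_le_left _ _).trans (min_le_right _ _)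
      have h' : r * (2 * (2 * (Real.sqrt 5 + 1))) ≤ δ := (le_div_iff₀ (by positivity)).1 h
      nlinarith [h', hr0, h51]
    have hrV : r * D * K ≤ V / 2 := by
      have h : r ≤ V / (2 * D * (K + 1)) := by rw [hr]; exact (min_le_right _ _).trans (min_le_left _ _)
      have h' : r * (2 * D * (K + 1)) ≤ V := (le_div_iff₀ (by positivity)).1 h
      have e1 : r * (2 * D * (K + 1)) = 2 * (r * D * K) + 2 * (r * D) := by ring
      rw [e1] at h'
      linarith [h', hrD0]
    have hrε : 6 * c * (r * D * K) / x ≤ ε / 3 := by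
      have h : r ≤ ε * x / (18 * c * D * (K + 1)) := by
        rw [hr]; exact (min_le_right _ _).trans (min_le_right _ _)
      have h' : r * (18 * c * D * (K + 1)) ≤ ε * x := (le_div_iff₀ (by positivity)).1 h
      rw [div_le_iff₀ hxpos]
      have e1 : r * (18 * c * D * (K + 1)) = 18 * (r * c * D * K) + 18 * (r * c * D) := by ring
      have e2 : 6 * c * (r * D * K) = 6 * (r * c * D * K) := by ring
      rw [e2]
      rw [e1] at h'
      linarith [h', hrcD]
    obtain ⟨ρ, hρ⟩ : ∃ ρ : ℝ, ρ = r * D := ⟨_, rfl⟩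
    have hρpos : 0 < ρ := by rw [hρ]; exact mul_pos hr0 hDpos
    -- trimming inside the slid nodes
    obtain ⟨Qt, hQtm, hQtsub, hQtdisj, hsepQt, hvolQt⟩ :=
      exists_superTree_trim Q hQo hdisj Bd τ nd slid (fun j j' h h' => hτ j j' h h') wS ρ
    have hQttop : volume (⋃ j, Qt j) ≠ ⊤ :=
      (lt_of_le_of_lt (measure_mono (iUnion_mono hQtsub)) hE'top.lt_top).ne
    have hslabfin : ∀ i j, (if (nd i = nd j ∧ slid (nd j) = true ∧ τ i = true ∧ τ j = false) then
        volume (Q j ∩ {x : E3 | ∃ s ∈ Icc (-ρ) ρ, x + s • wS (nd j) ∈ Q i}) else 0) ≠ ⊤ := by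
      intro i j
      split_ifs
      · exact (lt_of_le_of_lt (measure_mono inter_subset_left) (hvolQ j)).ne
      · exact ENNReal.zero_ne_top
    have hslabvol : ∀ i j, (if (nd i = nd j ∧ slid (nd j) = true ∧ τ i = true ∧ τ j = false) then
        volume (Q j ∩ {x : E3 | ∃ s ∈ Icc (-ρ) ρ, x + s • wS (nd j) ∈ Q i}) else 0).toReal ≤
        ρ * (if (nd i = nd j ∧ slid (nd j) = true ∧ τ i = true ∧ τ j = false) then term i j + ε₂ else 0) := by
      intro i j
      by_cases h : TP i j
      · rw [if_pos h, if_pos h]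
        exact hρ0 i j ρ hρpos (by rw [hρ]; exact lt_of_lt_of_le hrD (hρbar_le i j)) h
      · rw [if_neg h, if_neg h, ENNReal.toReal_zero, mul_zero]
    have htrimvol : V ≤ (volume (⋃ j, Qt j)).toReal + ρ * K := by
      have hsumfin : ∑ j, ∑ i, (if (nd i = nd j ∧ slid (nd j) = true ∧ τ i = true ∧ τ j = false) then
          volume (Q j ∩ {x : E3 | ∃ s ∈ Icc (-ρ) ρ, x + s • wS (nd j) ∈ Q i}) else 0) ≠ ⊤ :=
        ENNReal.sum_ne_top.2 fun j _ => ENNReal.sum_ne_top.2 fun i _ => hslabfin i j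
      have h2 := ENNReal.toReal_mono (ENNReal.add_ne_top.2 ⟨hQttop, hsumfin⟩) hvolQt
      rw [ENNReal.toReal_add hQttop hsumfin,
        ENNReal.toReal_sum (fun j _ => ENNReal.sum_ne_top.2 fun i _ => hslabfin i j)] at h2
      have h3 : ∑ j, (∑ i, (if (nd i = nd j ∧ slid (nd j) = true ∧ τ i = true ∧ τ j = false) then
          volume (Q j ∩ {x : E3 | ∃ s ∈ Icc (-ρ) ρ, x + s • wS (nd j) ∈ Q i}) else 0)).toReal ≤
          ρ * K := by
        calc ∑ j, (∑ i, (if (nd i = nd j ∧ slid (nd j) = true ∧ τ i = true ∧ τ j = false) then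
              volume (Q j ∩ {x : E3 | ∃ s ∈ Icc (-ρ) ρ, x + s • wS (nd j) ∈ Q i}) else 0)).toReal
            = ∑ j, ∑ i, (if (nd i = nd j ∧ slid (nd j) = true ∧ τ i = true ∧ τ j = false) then
              volume (Q j ∩ {x : E3 | ∃ s ∈ Icc (-ρ) ρ, x + s • wS (nd j) ∈ Q i}) else 0).toReal :=
              Finset.sum_congr rfl fun j _ => ENNReal.toReal_sum fun i _ => hslabfin i j
          _ ≤ ∑ j, ∑ i, ρ * (if (nd i = nd j ∧ slid (nd j) = true ∧ τ i = true ∧ τ j = false) then term i j + ε₂ else 0) :=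
              Finset.sum_le_sum fun j _ => Finset.sum_le_sum fun i _ => hslabvol i j
          _ = ρ * ∑ j, ∑ i, (if (nd i = nd j ∧ slid (nd j) = true ∧ τ i = true ∧ τ j = false) then term i j + ε₂ else 0) := by
              rw [Finset.mul_sum]; refine Finset.sum_congr rfl fun j _ => ?_; rw [Finset.mul_sum]
          _ ≤ ρ * K := by
              gcongr
              rw [hK, hTAB]
              calc ∑ j, ∑ i, (if (nd i = nd j ∧ slid (nd j) = true ∧ τ i = true ∧ τ j = false) then term i j + ε₂ else 0)
                  ≤ ∑ j, ∑ i, ((if (nd i = nd j ∧ slid (nd j) = true ∧ τ i = true ∧ τ j = false) then term i j else 0) + ε₂) := by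
                    refine Finset.sum_le_sum fun j _ => Finset.sum_le_sum fun i _ => ?_
                    split_ifs; exacts [le_rfl, by rw [zero_add]; exact hε₂pos.le]
                _ = (∑ j, ∑ i, (if (nd i = nd j ∧ slid (nd j) = true ∧ τ i = true ∧ τ j = false) then term i j else 0)) + (k : ℝ) ^ 2 * ε₂ := by
                    simp only [Finset.sum_add_distrib, Finset.sum_const, Finset.card_univ,
                      Fintype.card_fin]
                    ring
      linarith only [h2, h3]
    have hV'pos : 0 < (volume (⋃ j, Qt j)).toReal := by
      have : ρ * K ≤ V / 2 := by rw [hρ]; exact hrV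
      linarith only [htrimvol, this, hVpos]
    have hQt0 : volume (⋃ j, Qt j) ≠ 0 := fun h => by
      rw [h, ENNReal.toReal_zero] at hV'pos; exact lt_irrefl _ hV'pos
    obtain ⟨C, hC⟩ : ∃ C : Set E3, C = ⋃ f, ⋃ y ∈ Q f, y +ᵥ (r • W (A f)) := ⟨_, rfl⟩
    have hCopen : IsOpen C := by
      have hCeq : C = ⋃ f, ⋃ w' ∈ r • W (A f), (fun y => y + w') '' Q f := by
        ext y
        simp only [hC, mem_iUnion, Set.mem_vadd_set, vadd_eq_add, mem_image, exists_prop]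
        constructor
        · rintro ⟨f, z, hz, w', hw', rfl⟩; exact ⟨f, w', hw', z, hz, rfl⟩
        · rintro ⟨f, w', hw', z, hz, rfl⟩; exact ⟨f, z, hz, w', hw', rfl⟩
      rw [hCeq]
      exact isOpen_iUnion fun f => isOpen_biUnion fun w' _ => (isOpenMap_add_right w') _ (hQo f)
    have hCm : MeasurableSet C := hCopen.measurableSet
    have hEbd : Bornology.IsBounded (⋃ f, Q f) := Bornology.isBounded_iUnion.2 fun f => hbd f
    have hCfin : volume C ≠ ⊤ := by
      obtain ⟨R₁, hR₁⟩ := hEbd.subset_closedBall 0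
      have hCsub : C ⊆ Metric.closedBall (0 : E3) (R₁ + r * Real.sqrt 5) := by
        intro y hy
        rw [hC] at hy
        simp only [mem_iUnion, Set.mem_vadd_set, vadd_eq_add, exists_prop] at hy
        obtain ⟨f, z, hz, w', hw', rfl⟩ := hy
        obtain ⟨w5, hw5, rfl⟩ := Set.mem_smul_set.1 hw'
        have hz' : ‖z‖ ≤ R₁ := mem_closedBall_zero_iff.1 (hR₁ (mem_iUnion.2 ⟨f, hz⟩))
        have hw5' : ‖w5‖ ≤ Real.sqrt 5 :=
          mem_closedBall_zero_iff.1 (cruxWulffBody_subset_closedBall (A f) hw5)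
        rw [mem_closedBall_zero_iff]
        calc ‖z + r • w5‖ ≤ ‖z‖ + ‖r • w5‖ := norm_add_le _ _
          _ = ‖z‖ + r * ‖w5‖ := by rw [norm_smul, Real.norm_of_nonneg hr0.le]
          _ ≤ R₁ + r * Real.sqrt 5 := by gcongr
      exact (lt_of_le_of_lt (measure_mono hCsub) measure_closedBall_lt_top).ne
    have hlow := superTree_trimmed_lower Q hbd A nd par hpar nrm thr hn1 Aref hprof hGt hPt hfar
      slid mS uS wS hN1 hN2 (fun f hf => (hON f hf).1) (fun f hf => (hON f hf).2.1)
      (fun f hf => (hON f hf).2.2.1) (fun f hf => (hON f hf).2.2.2.1) (fun f hf => (hON f hf).2.2.2.2)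
      (fun f hf => (hBM f hf).1) (fun f hf => (hBM f hf).2) hNa hNb hr0 hrδ Qt hQtm hQtsub hQtdisj
      (fun j j' hjj hsl hne z hz t ht => hsepQt j j' hjj hsl hne z hz t (by rw [hρ, hD]; exact ht))
      hQt0 hCm
      (fun f z hz y hy => by
        rw [hC]
        exact mem_iUnion.2 ⟨f, mem_iUnion₂.2 ⟨z, hQtsub f hz,
          Set.mem_vadd_set.2 ⟨r • y, Set.smul_mem_smul_set hy, rfl⟩⟩⟩)
    have hupC : (volume C).toReal ≤ V + r * (F + ε / 3) := by rw [hC]; exact hup r hr0 hrr₁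
    obtain ⟨V', hV'⟩ : ∃ V' : ℝ, V' = (volume (⋃ j, Qt j)).toReal := ⟨_, rfl⟩
    have hexp : (((3 : ℕ) : ℝ)⁻¹) = (3 : ℝ)⁻¹ := by norm_num
    have h1 : V' ^ ((3 : ℝ)⁻¹) + r * c ≤ (volume C).toReal ^ ((3 : ℝ)⁻¹) := by
      have h := ENNReal.toReal_mono (ENNReal.rpow_ne_top_of_nonneg (by positivity) hCfin) hlow
      rw [ENNReal.toReal_add (ENNReal.rpow_ne_top_of_nonneg (by positivity) hQttop)
          (ENNReal.mul_ne_top ENNReal.ofReal_ne_top (ENNReal.rpow_ne_top_of_nonneg (by positivity)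
            ENNReal.ofReal_ne_top)),
        ENNReal.toReal_mul, ENNReal.toReal_ofReal hr0.le, ← ENNReal.toReal_rpow, ← ENNReal.toReal_rpow,
        ← ENNReal.toReal_rpow, ENNReal.toReal_ofReal (by norm_num : (0:ℝ) ≤ 32), hexp, ← hV'] at h
      exact h
    obtain ⟨x', hx'⟩ : ∃ x' : ℝ, x' = V' ^ ((3 : ℝ)⁻¹) := ⟨_, rfl⟩
    rw [← hx'] at h1
    have hV'0 : 0 ≤ V' := by rw [hV']; exact ENNReal.toReal_nonneg
    have hx'0 : 0 ≤ x' := by rw [hx']; positivity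
    have hx'3 : x' ^ 3 = V' := by
      rw [hx', show ((3 : ℝ)⁻¹) = ((3 : ℕ) : ℝ)⁻¹ by norm_num]
      exact Real.rpow_inv_natCast_pow hV'0 (by norm_num)
    have hC3 : ((volume C).toReal ^ ((3 : ℝ)⁻¹)) ^ 3 = (volume C).toReal := by
      rw [show ((3 : ℝ)⁻¹) = ((3 : ℕ) : ℝ)⁻¹ by norm_num]
      exact Real.rpow_inv_natCast_pow ENNReal.toReal_nonneg (by norm_num)
    have h2 : (x' + r * c) ^ 3 ≤ V + r * (F + ε / 3) := by
      calc (x' + r * c) ^ 3 ≤ ((volume C).toReal ^ ((3 : ℝ)⁻¹)) ^ 3 := by gcongr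
        _ = (volume C).toReal := hC3
        _ ≤ V + r * (F + ε / 3) := hupC
    have hVV' : V ≤ V' + r * D * K := by rw [hV', ← hρ]; exact htrimvol
    have hV'V : V' ≤ V := by
      rw [hV', hV]
      exact ENNReal.toReal_mono hE'top (measure_mono (iUnion_mono hQtsub))
    have hDK : D * K ≤ 1 / Real.sqrt 6 * S + ε / 3 := by
      rw [hK, mul_add]
      have hA : D * TAB ≤ 1 / Real.sqrt 6 * S := by
        rw [hD]
        have : 2 / Real.sqrt 6 * TAB = 1 / Real.sqrt 6 * (2 * TAB) := by ring
        rw [this]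
        exact mul_le_mul_of_nonneg_left hTABS (by positivity)
      have hB : D * ((k : ℝ) ^ 2 * ε₂) ≤ ε / 3 := by
        rw [hε₂, ← mul_div_assoc, ← mul_div_assoc, div_le_iff₀ (by positivity)]
        have hDε : 0 ≤ D * ε := by positivity
        have e : ε / 3 * (3 * D * ((k : ℝ) ^ 2 + 1)) = D * ((k : ℝ) ^ 2 * ε) + D * ε := by ring
        rw [e]
        linarith only [hDε]
      linarith only [hA, hB]
    exact cube_tail_bound hr0 hc0 hxpos hx'0 hx3 hx'3 hV'V hVV' h2 hrε hDK
  rw [wulff_constant_eq hV0]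
  exact le_of_forall_pos_le_add key

end Summit.Ventures.Crystal3D.Cruxes.PolycrystalWulffBound.PolyDensity

end
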